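/-
Copyright (c) 2026. All rights reserved.
Released under Apache 2.0 license as described in the file LICENSE.
Authors: abc-iut cell — statements drafted by seat abc-iut-L4-t2 (wave 1; audit A21-F5/F6 fixes applied
by t2); adopted and filed by seat abc-iut-L4-t14 (wave 2, L4 rulings σ/υ handover: announced names kept).
-/
import Literature.AnabelianGeometry.AbsoluteAnabelian.Coorientations
import Mathlib.AlgebraicTopology.FundamentalGroupoid.SimplyConnected
import Mathlib.Logic.Relation
import Literature.Geometry.Kaehler.ComplexTorusDeckTransformations
import HarnessLib

/-!
# Holomorphic arithmeticity and cores; linear structures via parallelograms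
# ([AbsTopIII] Cor 2.4, Prop 2.5, Rmk 2.5.1, Prop 2.6)

Third file of the statements-first typing (D-0014) of S. Mochizuki, *Topics in absolute anabelian
geometry III*, §2 (bib key `MochizukiAbsTopIII2015`; locators = kurims manuscript pages, lit key
`paper:url-5493eb38cbb7`).

* Cor 2.4 pp.54–55 — (a) `π₁(X^top)` as the deck transformation group `deckGroup`, (b) the lifted
  structure (`IsLiftedStructure`), `Aut(𝕌)` / `Aut⁰(𝕌)` (`autSet`, `autIdComponent`, compact-open
  topology) and the injection `π₁(X^top) ↪ Aut⁰(𝕌)` as the named `Prop` fact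
  `DeckGroupInAutIdComponent` (stated for a Riemann surface OF FINITE TYPE — `IsOfFiniteType`:
  biholomorphic to a compact Riemann surface minus finitely many points, the printed hypothesis — and
  for the lifted = charted structure on the disc `U`, so no junk structure can enter), (c) the commensurator criterion `IsMargulisNonArithmetic`
  ([Mzk3] §2–3 arithmeticity itself is not in the tree: the criterion is recorded as a
  definition) and the hyperbolic core as an orbispace quotient (`HyperbolicCoreOrbispace`: for
  `π = π₁(X^top)` the deck group, proper discontinuity + finite stabilisers + action by automorphisms).
* Prop 2.5 pp.55–57 — the "parallelograms, rectangles, squares" algorithm (a)–(e) as HONEST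
  DEFINITIONS on an abstract set `U` with a distinguished collection `𝒬` of subsets (namespace
  `Parallelograms`: strict line segments, chains, line segments, endpoints, `∂Q`, sides,
  (strictly) parallel, pre-∂-parallelograms, parallelograms, frames, framed, strictly co-oriented,
  orientations, local additive structure); the models `𝒫(U)`, `𝒮(U)` in `ℂ`; the claim "precisely
  2 orientations" as the named `Prop` fact `TwoOrientations`; Rmk 2.5.1 orthogonal frames.
* Prop 2.6 pp.57–58 — the local linear holomorphic structures `𝒜_p ≅ ℂ^×` with the transition
  isomorphisms `𝒜_p ⥲ 𝒜_{p'}` as the INTERFACE `LocalLinearHolStructure` (germ automorphism groups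
  are not constructed here).

Deliberately NOT here: Rmk 2.4.1/2.4.2/2.6.1 (discussion; abc-iut-L4-t14's `AbsTopIII/RemarksArchimedean`),
Cor 2.7–2.9 (file `ArchimedeanReconstruction`, abc-iut-L4-t12 under ruling υ).  HANDOVER (L4 rulings
σ/υ, 2026-08-25): abc-iut-L4-t2's staged draft with its audit fixes (A21-F5: `HyperbolicCoreOrbispace`
binds `π = π₁(X^top)` = the deck group; A21-F6: frames carry their parallelogram), adopted by
abc-iut-L4-t14 with every announced name kept and no change of content.  Refereed pre-IUT anabelian
geometry; nothing here bears on the disputed [IUTchIII] Cor. 3.12; named facts are quoted, not asserted.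
-/

namespace Literature.AnabelianGeometry.AbsoluteAnabelian

open _root_.TopologicalSpace _root_.Topology
open scoped _root_.Manifold _root_.ContDiff

universe u

/-! ### Corollary 2.4: holomorphic arithmeticity and cores -/

section Cores

variable {X : Type u} [TopologicalSpace X] {Ucov : Type u} [TopologicalSpace Ucov]

/-- **Cor 2.4 (a)**: for a universal covering `U^top → X^top` (a covering map from a simply
connected space), "one may construct the fundamental group `π₁(X^top)` as the group of
automorphisms `Aut(U^top/X^top)`" — the deck transformation group, as a subgroup of `Aut(U^top)`.
This is the tree's `Literature.Geometry.Kaehler.ComplexTorus.deckTransformations p` (Hatcher's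
`G(Y)`, stated there for an arbitrary map); we only give it the name used in this file.
[cite: MochizukiAbsTopIII2015, Corollary 2.4 (a) p.54] -/
abbrev deckGroup (p : Ucov → X) : Subgroup (Ucov ≃ₜ Ucov) :=
  Literature.Geometry.Kaehler.ComplexTorus.deckTransformations p

/-- **Cor 2.4 (b)**, the lifted structure: "by considering the local structure on `U^top` consisting
of connected open subsets of `U^top` that map isomorphically onto open subsets of `X^top`, one may
construct a natural pre-Aut-holomorphic structure on `U^top` — hence also [Cor 2.3 (ii)] a natural
Aut-holomorphic structure on `U^top` — by restricting the Aut-holomorphic structure of `𝕏`".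
Typed as the predicate "`𝒜_U` makes `p` a (𝒰, all)-local morphism for `𝒰` = the connected opens on
which `p` is injective" — this pins `𝒜_U` on the local structure `𝒰` only (the printed
PRE-Aut-holomorphic structure); its unique extension to all connected opens is Cor 2.3 (ii).
[cite: MochizukiAbsTopIII2015, Corollary 2.4 (b) p.54] -/
def IsLiftedStructure (A : AutHolStructure X) (p : Ucov → X) (AU : AutHolStructure Ucov) : Prop :=
  IsLocalMorphism AU A {V : Opens Ucov | IsConnected (V : Set Ucov) ∧ Set.InjOn p V}
    {W : Opens X | IsConnected (W : Set X)} p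

/-- The set `Aut(𝕌)` of automorphisms of an Aut-holomorphic space: self-homeomorphisms that are
morphisms of Aut-holomorphic spaces together with their inverses.
[cite: MochizukiAbsTopIII2015, Corollary 2.4 (b) p.54] -/
def autSet (AU : AutHolStructure Ucov) : Set (Ucov ≃ₜ Ucov) :=
  {φ | IsMorphism AU AU φ ∧ IsMorphism AU AU φ.symm}

attribute [local instance] homeoCompactOpen in
/-- `Aut⁰(𝕌) ⊆ Aut(𝕌)`: "the connected component of the identity of `Aut(𝕌)`", for the topology
induced by the compact-open topology of `Aut(U^top)`.
[cite: MochizukiAbsTopIII2015, Corollary 2.4 (b) p.54] -/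
def autIdComponent (AU : AutHolStructure Ucov) : Set (Ucov ≃ₜ Ucov) :=
  Subtype.val '' connectedComponent
    (⟨Homeomorph.refl Ucov, AU.isMorphism_id, AU.isMorphism_id⟩ : autSet AU)

/-- WITNESS that a Riemann surface `X` is of finite type: a compact connected Riemann surface `X̄`, a
finite set `S ⊆ X̄` and a biholomorphism `X ≅ X̄ ∖ S` — i.e. `X` is the Riemann surface "determined by"
an algebraic curve over `ℂ` (GAGA); Cor 2.4 p.54 is stated for "a hyperbolic Aut-holomorphic space of
finite type associated to a Riemann surface `X` [which is, in turn, determined by a hyperbolic curve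
over `ℂ`]" (Def 2.1 (i) p.50: "hyperbolic Riemann surface of finite type").
[cite: MochizukiAbsTopIII2015, Corollary 2.4 p.54] -/
structure FiniteTypeWitness (X : Type) [TopologicalSpace X] [ChartedSpace ℂ X] : Type 1 where
  /-- the compactification `X̄` -/
  Xc : Type
  [top : TopologicalSpace Xc]
  [t2 : T2Space Xc]
  [compact : CompactSpace Xc]
  [connected : ConnectedSpace Xc]
  [chart : ChartedSpace ℂ Xc]
  [manifold : IsManifold 𝓘(ℂ, ℂ) ω Xc]
  /-- the finitely many points removed -/
  S : Finset Xc
  /-- the biholomorphism `X ≅ X̄ ∖ S` (a homeomorphism onto the open complement, holomorphic both ways) -/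
  e : X ≃ₜ ((⟨((S : Set Xc))ᶜ, S.finite_toSet.isClosed.isOpen_compl⟩ : Opens Xc) : Type)
  hol : MDifferentiable 𝓘(ℂ, ℂ) 𝓘(ℂ, ℂ) e
  hol_symm : MDifferentiable 𝓘(ℂ, ℂ) 𝓘(ℂ, ℂ) e.symm

/-- `X` is a Riemann surface **of finite type**: it admits a `FiniteTypeWitness` (the printed standing
hypothesis of Cor 2.4; together with "the universal covering is an Aut-holomorphic disc" this is exactly
"determined by a HYPERBOLIC curve over `ℂ`", by uniformisation).
[cite: MochizukiAbsTopIII2015, Corollary 2.4 p.54] -/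
def IsOfFiniteType (X : Type) [TopologicalSpace X] [ChartedSpace ℂ X] : Prop :=
  Nonempty (FiniteTypeWitness X)

/-- **Cor 2.4 (b)**, the injection: for `𝕏` a hyperbolic Aut-holomorphic space of finite type (here: a
Riemann surface `X` OF FINITE TYPE (`IsOfFiniteType`, the printed hypothesis) whose universal covering
`U^top → X^top` — a surjective covering map from a simply connected `U` — carries the lifted complex
structure making `p` holomorphic and `𝕌` an Aut-holomorphic disc, i.e. `X` is hyperbolic) "we obtain a
natural injection `π₁(X^top) = Aut(U^top/X^top) ↪ Aut⁰(𝕌) ⊆ Aut(𝕌)`",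
`Aut(𝕌)` carrying the compact-open topology (≅ `GL₂(ℝ)/ℝ^×`, Prop 2.2 (ii), Cor 2.3 (i)).  Typed: deck
transformations are automorphisms of the lifted Aut-holomorphic structure lying in `Aut⁰`.  Named
`Prop` fact.
[cite: MochizukiAbsTopIII2015, Corollary 2.4 (b) p.54] -/
def DeckGroupInAutIdComponent : Prop :=
  ∀ (X : Type) [TopologicalSpace X] [T2Space X] [ChartedSpace ℂ X] [IsManifold 𝓘(ℂ, ℂ) ω X]
    (Ucov : Type) [TopologicalSpace Ucov] [SimplyConnectedSpace Ucov] [ChartedSpace ℂ Ucov]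
    [IsManifold 𝓘(ℂ, ℂ) ω Ucov] (p : Ucov → X), IsOfFiniteType X →
    IsCoveringMap p → Function.Surjective p → MDifferentiable 𝓘(ℂ, ℂ) 𝓘(ℂ, ℂ) p →
    IsAutHolDisc Ucov →
      ((deckGroup p : Subgroup (Ucov ≃ₜ Ucov)) : Set (Ucov ≃ₜ Ucov)) ⊆
        autIdComponent (AutHolStructure.ofCharted Ucov)

/-- **Cor 2.4 (c)**, the criterion: with `π₁(X^top) ↪ Aut⁰(𝕌)` as in (b) and `Π ⊆ Aut⁰(𝕌)` the
commensurator of the image, "`X` is not arithmetic if and only if the image of `π₁(X^top)` in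
`Aut⁰(𝕌)` is of finite index in its commensurator `Π`" ([Mzk3] §2, §3 — Margulis' criterion).
Since [Mzk3]'s arithmeticity is not in the tree, the right-hand side is recorded as the DEFINITION
`IsMargulisNonArithmetic` (relative to a subgroup `G` playing `Aut⁰(𝕌)`); Cor 2.4 (c) is the
assertion that it agrees with non-arithmeticity in the sense of [Mzk3] §2 (not separately typed).
[cite: MochizukiAbsTopIII2015, Corollary 2.4 (c) pp.54–55] -/
def IsMargulisNonArithmetic {A : Type u} [Group A] (G : Subgroup A) (π : Subgroup A) : Prop :=
  π ≤ G ∧ ((π.subgroupOf G).relIndex (Subgroup.Commensurable.commensurator (π.subgroupOf G))) ≠ 0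

/-- **Cor 2.4 (c)**, the hyperbolic core: "if `X` is not arithmetic, then the Aut-holomorphic orbispace
`𝕏 → ℍ` associated to the hyperbolic core `H` of `X` may be constructed by forming the 'orbispace
quotient' of `U^top` by `Π`" (the commensurator) "and equipping this quotient with the
pre-Aut-holomorphic structure … determined by restricting the Aut-holomorphic structure of `𝕌`".
Typed in the setting of (b) — `X` a Riemann surface OF FINITE TYPE (`IsOfFiniteType`) with holomorphic
universal covering `p : U → X` from an Aut-holomorphic disc, `π := π₁(X^top) = Aut(U^top/X^top)` (the
printed standing hypothesis; audit A21-F5), `G = Aut⁰(𝕌)`, `π` non-arithmetic in the commensurator sense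
—: the commensurator `Π` acts on `U^top` PROPERLY DISCONTINUOUSLY with FINITE stabilisers by
automorphisms of `𝕌`, i.e. the data from which an Aut-holomorphic orbispace presentation `[𝕌/Π]`
(Rmk 2.1.1, `AutHolOrbiPresentation`) is assembled.  Named `Prop` fact.
[cite: MochizukiAbsTopIII2015, Corollary 2.4 (c) p.55] -/
def HyperbolicCoreOrbispace : Prop :=
  ∀ (X : Type) [TopologicalSpace X] [T2Space X] [ChartedSpace ℂ X] [IsManifold 𝓘(ℂ, ℂ) ω X]
    (Ucov : Type) [TopologicalSpace Ucov] [SimplyConnectedSpace Ucov] [ChartedSpace ℂ Ucov]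
    [IsManifold 𝓘(ℂ, ℂ) ω Ucov] (p : Ucov → X), IsOfFiniteType X →
    IsCoveringMap p → Function.Surjective p → MDifferentiable 𝓘(ℂ, ℂ) 𝓘(ℂ, ℂ) p →
    IsAutHolDisc Ucov → ∀ (G : Subgroup (Ucov ≃ₜ Ucov)),
    (G : Set (Ucov ≃ₜ Ucov)) = autIdComponent (AutHolStructure.ofCharted Ucov) →
    IsMargulisNonArithmetic G (deckGroup p) →
    let Pc : Subgroup (Ucov ≃ₜ Ucov) :=
      (Subgroup.Commensurable.commensurator ((deckGroup p).subgroupOf G)).map G.subtype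
    (∀ K L : Set Ucov, IsCompact K → IsCompact L →
        {γ : Ucov ≃ₜ Ucov | γ ∈ Pc ∧ (γ '' K ∩ L).Nonempty}.Finite) ∧
      (∀ x : Ucov, {γ : Ucov ≃ₜ Ucov | γ ∈ Pc ∧ γ x = x}.Finite) ∧
      ((Pc : Set (Ucov ≃ₜ Ucov)) ⊆ autSet (AutHolStructure.ofCharted Ucov))

end Cores

/-! ### Proposition 2.5: linear structures via parallelograms, rectangles, squares -/

namespace Parallelograms

variable {U : Type u} (𝒬 : Set (Set U))

/-- The topology on the abstract set `U` determined by the distinguished open subsets `𝒬(U)`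
("which clearly forms a basis for, hence determines, the topology of `U`").
[cite: MochizukiAbsTopIII2015, Proposition 2.5 p.56] -/
@[reducible] def topology : TopologicalSpace U := TopologicalSpace.generateFrom 𝒬

/-- **Prop 2.5 (a)**: a **strict line segment** of `U`: an infinite intersection `Q̄₁ ∩ Q̄₂` of the
closures of two disjoint members `Q₁, Q₂ ∈ 𝒬(U)`.
[cite: MochizukiAbsTopIII2015, Proposition 2.5 (a) p.56] -/
def IsStrictLineSegment (L : Set U) : Prop :=
  ∃ Q₁ ∈ 𝒬, ∃ Q₂ ∈ 𝒬, Q₁ ∩ Q₂ = ∅ ∧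
    L = @closure U (topology 𝒬) Q₁ ∩ @closure U (topology 𝒬) Q₂ ∧ L.Infinite

/-- **Prop 2.5 (a)**: two strict line segments are **strictly collinear** if their intersection is
infinite.
[cite: MochizukiAbsTopIII2015, Proposition 2.5 (a) p.56] -/
def StrictlyCollinear (L₁ L₂ : Set U) : Prop := (L₁ ∩ L₂).Infinite

/-- **Prop 2.5 (a)**: a **strict chain**: a finite ordered list of `n ≥ 2` strict line segments,
consecutive ones strictly collinear.
[cite: MochizukiAbsTopIII2015, Proposition 2.5 (a) p.56] -/
def IsStrictChain (c : List (Set U)) : Prop :=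
  2 ≤ c.length ∧ (∀ L ∈ c, IsStrictLineSegment 𝒬 L) ∧
    List.IsChain (StrictlyCollinear (U := U)) c

/-- **Prop 2.5 (a)**: a **line segment** of `U`: "the union of strict line segments contained [in] a
strict chain".
[cite: MochizukiAbsTopIII2015, Proposition 2.5 (a) p.56] -/
def IsLineSegment (L : Set U) : Prop :=
  ∃ c : List (Set U), IsStrictChain 𝒬 c ∧ L = ⋃ M ∈ c, M

/-- **Prop 2.5 (a)**: the **endpoints** `∂L` of a line segment: points "whose complement in `L` is
connected".
[cite: MochizukiAbsTopIII2015, Proposition 2.5 (a) p.56] -/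
def endpoints (L : Set U) : Set U :=
  {x | x ∈ L ∧ @IsConnected U (topology 𝒬) (L \ {x})}

/-- **Prop 2.5 (b)**: the **`∂𝒬`-parallelogram** `∂Q := Q̄ ∖ Q` of `Q ∈ 𝒬(U)`.
[cite: MochizukiAbsTopIII2015, Proposition 2.5 (b) p.56] -/
def boundaryOf (Q : Set U) : Set U := @closure U (topology 𝒬) Q \ Q

/-- **Prop 2.5 (b)**: a **side** of `Q ∈ 𝒬(U)`: a maximal line segment contained in `∂Q`.
[cite: MochizukiAbsTopIII2015, Proposition 2.5 (b) p.56] -/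
def IsSide (Q S : Set U) : Prop :=
  Q ∈ 𝒬 ∧ IsLineSegment 𝒬 S ∧ S ⊆ boundaryOf 𝒬 Q ∧
    ∀ S', IsLineSegment 𝒬 S' → S' ⊆ boundaryOf 𝒬 Q → S ⊆ S' → S' = S

/-- **Prop 2.5 (b)**: line segments `L, L'` are **strictly parallel** "if there exist
non-intersecting sides `S, S'` of a parallelogram `∈ 𝒬(U)` such that `S ⊆ L`, `S' ⊆ L'`".
[cite: MochizukiAbsTopIII2015, Proposition 2.5 (b) p.56] -/
def StrictlyParallel (L L' : Set U) : Prop :=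
  ∃ Q ∈ 𝒬, ∃ S S', IsSide 𝒬 Q S ∧ IsSide 𝒬 Q S' ∧ S ∩ S' = ∅ ∧ S ⊆ L ∧ S' ⊆ L'

/-- **Prop 2.5 (b)**: `L, L'` are **parallel** iff equivalent "relative to the equivalence relation
on line segments generated by the relation of inclusion and the relation of being strictly
parallel".
[cite: MochizukiAbsTopIII2015, Proposition 2.5 (b) p.56] -/
def Parallel (L L' : Set U) : Prop :=
  IsLineSegment 𝒬 L ∧ IsLineSegment 𝒬 L' ∧
    Relation.EqvGen (fun M M' : Set U => IsLineSegment 𝒬 M ∧ IsLineSegment 𝒬 M' ∧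
      (M ⊆ M' ∨ StrictlyParallel 𝒬 M M')) L L'

/-- **Prop 2.5 (c)**: a **pre-∂-parallelogram** `∂P = ⋃ L_i` (`i ∈ ℤ/4ℤ`): four line segments such
that any two distinct points of `∂P` are the endpoints of some line segment, `L_i ∥ L_{i+2}`
non-intersecting, and `L_i ∩ L_{i+1} = ∂L_i ∩ ∂L_{i+1}` has cardinality one.
[cite: MochizukiAbsTopIII2015, Proposition 2.5 (c) p.56] -/
def IsPreBoundaryParallelogram (L : ZMod 4 → Set U) : Prop :=
  (∀ i, IsLineSegment 𝒬 (L i)) ∧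
  (∀ p₁ p₂, p₁ ∈ ⋃ i, L i → p₂ ∈ ⋃ i, L i → p₁ ≠ p₂ →
    ∃ M, IsLineSegment 𝒬 M ∧ endpoints 𝒬 M = {p₁, p₂}) ∧
  (∀ i, Parallel 𝒬 (L i) (L (i + 2)) ∧ L i ∩ L (i + 2) = ∅) ∧
  (∀ i, L i ∩ L (i + 1) = endpoints 𝒬 (L i) ∩ endpoints 𝒬 (L (i + 1)) ∧
    ∃ x, L i ∩ L (i + 1) = {x})

/-- **Prop 2.5 (c)**: the **pre-parallelogram** of a pre-∂-parallelogram `∂P`: "the union of line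
segments `L` of `U` such [that] `∂L ⊆ ∂P`"; the **parallelograms** of `U` are the interiors of the
pre-parallelograms.
[cite: MochizukiAbsTopIII2015, Proposition 2.5 (c) p.56] -/
def parallelograms : Set (Set U) :=
  {P | ∃ L : ZMod 4 → Set U, IsPreBoundaryParallelogram 𝒬 L ∧
    P = @interior U (topology 𝒬)
      (⋃₀ {M | IsLineSegment 𝒬 M ∧ endpoints 𝒬 M ⊆ ⋃ i, L i})}

/-- **Prop 2.5 (d)**: a **frame** `F = (S₁, S₂)` of `U` at `p`, WITH ITS PARALLELOGRAM `P`: an ordered pair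
of distinct intersecting sides of a parallelogram `P ∈ 𝒫(U)` (the constructed parallelograms) with
`S₁ ∩ S₂ = {p}` (the parallelogram is carried along, as the relation "framed by `F`" refers to it —
audit A21-F6).
[cite: MochizukiAbsTopIII2015, Proposition 2.5 (d) p.56] -/
def IsFrameOf (p : U) (P : Set U) (F : Set U × Set U) : Prop :=
  P ∈ parallelograms 𝒬 ∧ IsSide (parallelograms 𝒬) P F.1 ∧ IsSide (parallelograms 𝒬) P F.2 ∧
    F.1 ≠ F.2 ∧ F.1 ∩ F.2 = {p}

/-- **Prop 2.5 (d)**: a line segment is **framed by** the frame `F` (with parallelogram `P`) if it "has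
infinite intersection with `P`".
[cite: MochizukiAbsTopIII2015, Proposition 2.5 (d) p.56] -/
def IsFramedBy (P : Set U) (L : Set U) : Prop := IsLineSegment 𝒬 L ∧ (L ∩ P).Infinite

/-- **Prop 2.5 (d)**: frames `F = (S₁,S₂)` (parallelogram `P`) and `F' = (S₁',S₂')` (parallelogram `P'`) at
`p` are **strictly co-oriented** "if `S₁'` is framed by `F`, and `S₂` is framed by `F'`".
[cite: MochizukiAbsTopIII2015, Proposition 2.5 (d) p.56] -/
def StrictlyCoOriented (P : Set U) (F : Set U × Set U) (P' : Set U) (F' : Set U × Set U) : Prop :=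
  IsFramedBy 𝒬 P F'.1 ∧ IsFramedBy 𝒬 P' F.2

/-- **Prop 2.5 (d)**: the **orientations** of `U` at `p`: equivalence classes of frames at `p` (each
with its parallelogram) for the equivalence relation generated by strict co-orientation ("of which
there are precisely 2" — see `TwoOrientations`).
[cite: MochizukiAbsTopIII2015, Proposition 2.5 (d) p.56] -/
def Orientations (p : U) : Type u :=
  Quot (fun (F F' : {PF : Set U × (Set U × Set U) // IsFrameOf 𝒬 p PF.1 PF.2}) =>
    StrictlyCoOriented 𝒬 F.1.1 F.1.2 F'.1.1 F'.1.2)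

/-- **Prop 2.5 (e)**: the **local additive structure** at `p`: `a +_p b = c` ("relative to the origin
`p`"): `p +_p b = b`, `a +_p p = a`, and for `a, b ≠ p`, `c` is "the unique endpoint of a side of `P`
that `∉ {a, b, p}`" for a parallelogram `P` with intersecting sides `S_a ∋ a`, `S_b ∋ b`,
`S_a ∩ S_b = {p}`, `∂S_a = {p,a}`, `∂S_b = {p,b}` (a partially defined operation, typed as a
relation).
[cite: MochizukiAbsTopIII2015, Proposition 2.5 (e) p.57] -/
def LocalAdd (p a b c : U) : Prop :=
  (a = p ∧ c = b) ∨ (b = p ∧ c = a) ∨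
  (a ≠ p ∧ b ≠ p ∧ ∃ P ∈ parallelograms 𝒬, ∃ Sa Sb,
    IsSide (parallelograms 𝒬) P Sa ∧ IsSide (parallelograms 𝒬) P Sb ∧ Sa ∩ Sb = {p} ∧
    endpoints 𝒬 Sa = {p, a} ∧ endpoints 𝒬 Sb = {p, b} ∧
    c ∉ ({a, b, p} : Set U) ∧ (∃ S, IsSide (parallelograms 𝒬) P S ∧ c ∈ endpoints 𝒬 S) ∧
    ∀ c', c' ∉ ({a, b, p} : Set U) → (∃ S, IsSide (parallelograms 𝒬) P S ∧ c' ∈ endpoints 𝒬 S) →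
      c' = c)

/-- **Rmk 2.5.1**: a frame at `p` is **orthogonal** "if it arises from an ordered pair of distinct
intersecting sides of a rectangle `∈ ℛ(U) ⊆ 𝒫(U)`" — typed relative to the sub-collection `ℛ`.
[cite: MochizukiAbsTopIII2015, Remark 2.5.1 p.57] -/
def IsOrthogonalFrame (ℛ : Set (Set U)) (p : U) (F : Set U × Set U) : Prop :=
  ∃ R ∈ ℛ, IsFrameOf 𝒬 p R F

end Parallelograms

/-- The open parallelogram in `ℂ` with vertex `z` and edge vectors `v, w` (`ℝ`-linearly
independent): `{z + s v + t w | 0 < s, t < 1}` — "the distinguished open subsets of `ℂ = ℝ + iℝ`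
which are of the form suggested by" the term ([Mzk14] Def A.3 as recalled on p.55).
[cite: MochizukiAbsTopIII2015, Proposition 2.5 p.55] -/
def openParallelogram (z v w : ℂ) : Set ℂ :=
  {x | ∃ s t : ℝ, 0 < s ∧ s < 1 ∧ 0 < t ∧ t < 1 ∧ x = z + (s : ℂ) * v + (t : ℂ) * w}

/-- `𝒫(U)`: the pre-compact parallelograms in an open `U ⊆ ℂ` (closure contained in `U`);
`ℛ(U)` (rectangles: `w ⊥ v`) and `𝒮(U)` (squares: `w = ± i v`) are the evident sub-collections.
[cite: MochizukiAbsTopIII2015, Proposition 2.5 p.55] -/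
def parallelogramsIn (U : Set ℂ) : Set (Set ℂ) :=
  {P | ∃ z v w : ℂ, LinearIndependent ℝ ![v, w] ∧ P = openParallelogram z v w ∧ closure P ⊆ U}

/-- `𝒮(U) ⊆ 𝒫(U)`: the pre-compact squares in `U`.
[cite: MochizukiAbsTopIII2015, Proposition 2.5 p.55] -/
def squaresIn (U : Set ℂ) : Set (Set ℂ) :=
  {P | ∃ z v : ℂ, v ≠ 0 ∧ P = openParallelogram z v (Complex.I * v) ∧ closure P ⊆ U}

/-- **Prop 2.5**, the claim for squares: for a connected open `U ⊆ ℂ` and `𝒬 = 𝒮(U)`, the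
algorithm (a)–(d) recovers the parallelograms and "the orientations of `U` at `p` [of which there
are precisely 2]" — typed: `parallelograms 𝒮(U) = 𝒫(U)` (as subsets of `U`) and the orientation
type at every point has exactly two elements.  Named `Prop` fact.
[cite: MochizukiAbsTopIII2015, Proposition 2.5 pp.55–57] -/
def TwoOrientations : Prop :=
  ∀ (U : Set ℂ), IsOpen U → IsConnected U →
    (Parallelograms.parallelograms {Q : Set U | Subtype.val '' Q ∈ squaresIn U} =
      {P : Set U | Subtype.val '' P ∈ parallelogramsIn U}) ∧
    ∀ p : U, Nonempty (Parallelograms.Orientations {Q : Set U | Subtype.val '' Q ∈ squaresIn U} p ≃ Bool)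

/-! ### Proposition 2.6: local linear holomorphic structures (interface) -/

/-- **Prop 2.6 (a), (b): the local linear holomorphic structure** of `(U, 𝒬(U))`, `𝒬 ∈ {𝒮, ℛ}`: for
`p ∈ U` the group `𝒜_p` "of automorphisms of the projective system of connected open
neighborhoods of `p` in `U` that are compatible with the local additive structures … and preserve
the orthogonal frames and orientations", topologised; (a) "a natural isomorphism of topological
groups `ℂ^× ⥲ 𝒜_p` … compatible with the topological field structures" on `𝒜_p ∪ {0}`; (b) for
`p, p' ∈ U` "a natural isomorphism of topological groups `𝒜_p ⥲ 𝒜_{p'}`", independent of the chain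
of neighbourhoods used, compatible with the field structures.  INTERFACE (the germ groups are
not constructed here): the data `𝒜`, the isomorphisms (a), (b) and their compatibilities as
topological GROUP isomorphisms; the printed compatibility "with the topological field structures on
`𝒜_p ∪ {0}`" is not recorded as a field (the field structure transported along `isoUnits` is the only
one in play here) — a weaker interface, deliberately.
[cite: MochizukiAbsTopIII2015, Proposition 2.6 pp.57–58] -/
structure LocalLinearHolStructure (U : Type u) : Type (u + 1) where
  /-- `𝒜_p` ("`ℂ^×` at `p`"). -/
  A : U → Type u
  [grp : ∀ p, Group (A p)]
  [top : ∀ p, TopologicalSpace (A p)]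
  /-- (a) the natural isomorphism `ℂ^× ⥲ 𝒜_p`. -/
  isoUnits : ∀ p, ℂˣ ≃ₜ* A p
  /-- (b) the natural isomorphisms `𝒜_p ⥲ 𝒜_{p'}`. -/
  trans : ∀ p p', A p ≃ₜ* A p'
  trans_self : ∀ p, trans p p = ContinuousMulEquiv.refl (A p)
  trans_comp : ∀ p p' p'', (trans p p').trans (trans p' p'') = trans p p''
  trans_isoUnits : ∀ p p', (isoUnits p).trans (trans p p') = isoUnits p'

attribute [instance] LocalLinearHolStructure.grp LocalLinearHolStructure.top

end Literature.AnabelianGeometry.AbsoluteAnabelian
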